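import Mathlib.Geometry.Manifold.Instances.Sphere
import Mathlib.Geometry.Manifold.Immersion
import Mathlib.Topology.Homotopy.Equiv
import Mathlib.Analysis.SpecialFunctions.Pow.Real
import HarnessLib

/-!
# The 4-sphere with a corrupted `C⁰` atlas: a charted space whose maximal `C^∞` atlas has a hole

Topic `Literature/Geometry/Manifold` (general infrastructure; written by the standing disprover of crux `ThinCrossSectionExists` of
route `SmoothPoincare4/CylinderEntropy` to show that the frame hypothesis `[IsManifold (𝓡 4) ∞ M]` of the SPC4-type items is
load-bearing, not implied by `ChartedSpace` + topology).

`Cor` is a copy of the topological 4-sphere charted by ALL of Mathlib's stereographic charts plus ONE extra chart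
`σ₃ = deg ∘ σ₁`, where `deg` cubes one coordinate about the chart value `y₀` of the base point: a homeomorphism of `ℝ⁴`,
differentiable at `y₀` with non-injective derivative, so that its inverse is not differentiable at `y₀`
(`not_differentiableAt_deg_symm`, chain rule).  Consequences, all proved:

* `not_mem_maximalAtlas` — **no chart of the maximal `C^∞` atlas of `Cor` contains the base point** (it would be smoothly
  compatible with `σ₁` and with `σ₃`, making `deg⁻¹ = σ₁ ∘ e⁻¹ ∘ e ∘ σ₃⁻¹` smooth at `y₀`);
* `not_isImmersion` — hence **no map `Cor → ℝ⁶` is a `C^∞` immersion** in Mathlib's sense (`Manifold.IsImmersion` asks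
  for slice charts of the maximal atlases), in particular no `Manifold.IsSmoothEmbedding`; the proof is target-independent:
  `not_isImmersion_general` (any model `J`, any target manifold `N`);
* `not_isManifold` — `Cor` is a `ChartedSpace (EuclideanSpace ℝ (Fin 4))` (compact, Hausdorff, second countable, `≃ₕ S⁴`:
  `corHomotopyEquiv`) which is NOT `IsManifold (𝓡 4) ∞`.

Everything is proved; no facts and no `Prop`-valued definitions.

## References
* J. M. Lee, *Introduction to Smooth Manifolds*, 2nd ed. (2013), Ch. 1, "Smooth structures" (an atlas determines a smooth
  structure iff its charts are pairwise smoothly compatible; the homeomorphism `x ↦ x³` of `ℝ` as the standard example of an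
  incompatible chart, Example 1.23 / Problem 1-6).
-/

noncomputable section

open scoped Manifold ContDiff Topology
open Set Function Filter

namespace Literature.Geometry.Manifold.CorruptedAtlasSphere

local notation "E⁴" => EuclideanSpace ℝ (Fin 4)
local notation "𝕊⁴" => (Metric.sphere (0 : EuclideanSpace ℝ (Fin 5)) 1)
/-! ### A degenerate self-homeomorphism of `ℝ⁴`: cube the first coordinate -/

/-- `t ↦ t³` is onto `ℝ` (intermediate values). [folklore] -/
lemma cube_surjective : Surjective fun t : ℝ => t ^ 3 := by
  have hc : Continuous fun t : ℝ => t ^ 3 := by fun_prop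
  refine hc.surjective (tendsto_pow_atTop (by norm_num)) ?_
  have h1 : Tendsto (fun t : ℝ => (-t) ^ 3) atBot atTop :=
    (tendsto_pow_atTop (by norm_num)).comp tendsto_neg_atBot_atTop
  have h2 := tendsto_neg_atTop_atBot.comp h1
  refine h2.congr fun t => ?_
  simp only [Function.comp_apply]; ring

/-- `t ↦ t³` as an order isomorphism of `ℝ`, hence a homeomorphism. [folklore] -/
def cubeIso : ℝ ≃o ℝ :=
  StrictMono.orderIsoOfSurjective (fun t : ℝ => t ^ 3) (Odd.strictMono_pow ⟨1, rfl⟩) cube_surjective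

/-- `t ↦ t³` as a self-homeomorphism of `ℝ`. [folklore] -/
def cubeH : ℝ ≃ₜ ℝ := cubeIso.toHomeomorph

/-- Value of the cube homeomorphism. [folklore] -/
@[simp] lemma cubeH_apply (t : ℝ) : cubeH t = t ^ 3 := rfl

/-- Cube the `0`-th coordinate of `Fin 4 → ℝ`. [folklore] -/
def degPi : (Fin 4 → ℝ) ≃ₜ (Fin 4 → ℝ) :=
  Homeomorph.piCongrRight fun i => if i = 0 then cubeH else Homeomorph.refl ℝ

/-- Coordinates of `degPi`. [folklore] -/
lemma degPi_apply (f : Fin 4 → ℝ) (i : Fin 4) :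
    degPi f i = if i = 0 then f i ^ 3 else f i := by
  unfold degPi
  rw [Homeomorph.piCongrRight_apply]
  split_ifs with h
  · subst h; rfl
  · rfl

/-- The (singular) derivative of `degPi` at `0`. [folklore] -/
def LPi : (Fin 4 → ℝ) →L[ℝ] (Fin 4 → ℝ) :=
  ContinuousLinearMap.pi fun i => if i = 0 then 0 else ContinuousLinearMap.proj i

/-- `degPi` is differentiable at `0` with the singular derivative `LPi`. [folklore] -/
lemma hasFDerivAt_degPi : HasFDerivAt degPi LPi 0 := by
  rw [show (degPi : (Fin 4 → ℝ) → (Fin 4 → ℝ)) = fun f i => if i = 0 then f i ^ 3 else f i from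
    funext fun f => funext fun i => degPi_apply f i]
  apply hasFDerivAt_pi.mpr
  intro i
  by_cases h : i = 0
  · subst h
    simp only [if_true]
    have h0 : HasFDerivAt (fun f : Fin 4 → ℝ => f 0) (ContinuousLinearMap.proj (R := ℝ) (0 : Fin 4))
        (0 : Fin 4 → ℝ) := hasFDerivAt_apply 0 0
    have := h0.pow 3
    simpa [LPi] using this
  · simp only [h, if_false]
    have hi : HasFDerivAt (fun f : Fin 4 → ℝ => f i) (ContinuousLinearMap.proj (R := ℝ) i)
        (0 : Fin 4 → ℝ) := hasFDerivAt_apply i 0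
    simpa [LPi, h] using hi

/-- `ℝ⁴ ≃L (Fin 4 → ℝ)`, Mathlib's `EuclideanSpace.equiv`. [folklore] -/
def eqv : E⁴ ≃L[ℝ] (Fin 4 → ℝ) := EuclideanSpace.equiv (Fin 4) ℝ

/-- Cube the `0`-th coordinate of `ℝ⁴ = EuclideanSpace ℝ (Fin 4)`. [folklore] -/
def deg₀ : E⁴ ≃ₜ E⁴ := eqv.toHomeomorph.trans (degPi.trans eqv.symm.toHomeomorph)

/-- The singular derivative of `deg₀` at the origin. [folklore] -/
def L₀ : E⁴ →L[ℝ] E⁴ := (eqv.symm : (Fin 4 → ℝ) →L[ℝ] E⁴).comp (LPi.comp (eqv : E⁴ →L[ℝ] (Fin 4 → ℝ)))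

/-- `deg₀` as a composite. [folklore] -/
lemma deg₀_eq : (deg₀ : E⁴ → E⁴) = eqv.symm ∘ degPi ∘ eqv := rfl

/-- `deg₀` is differentiable at `0` with derivative `L₀`. [folklore] -/
lemma hasFDerivAt_deg₀ : HasFDerivAt deg₀ L₀ 0 := by
  rw [deg₀_eq]
  have h1 : HasFDerivAt (eqv : E⁴ → (Fin 4 → ℝ)) (eqv : E⁴ →L[ℝ] (Fin 4 → ℝ)) 0 := eqv.hasFDerivAt
  have h2 : HasFDerivAt degPi LPi (eqv (0 : E⁴)) := by rw [map_zero]; exact hasFDerivAt_degPi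
  have h3 : HasFDerivAt (eqv.symm : (Fin 4 → ℝ) → E⁴) (eqv.symm : (Fin 4 → ℝ) →L[ℝ] E⁴)
      (degPi (eqv (0 : E⁴))) := eqv.symm.hasFDerivAt
  exact h3.comp 0 (h2.comp 0 h1)

/-- `deg₀ 0 = 0`. [folklore] -/
lemma deg₀_zero : deg₀ (0 : E⁴) = 0 := by
  rw [deg₀_eq]
  simp only [Function.comp_apply, map_zero]
  have : degPi 0 = 0 := by ext i; rw [degPi_apply]; split_ifs <;> simp
  rw [this, map_zero]

/-- `L₀ e₀ = 0`: the derivative is not injective. [folklore] -/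
lemma L₀_single : L₀ (EuclideanSpace.single (0 : Fin 4) (1 : ℝ)) = 0 := by
  have : LPi (eqv (EuclideanSpace.single (0 : Fin 4) (1 : ℝ))) = 0 := by
    ext i
    simp only [LPi, ContinuousLinearMap.pi_apply, Pi.zero_apply]
    split_ifs with h
    · rfl
    · simp [eqv, h]
  simp only [L₀, ContinuousLinearMap.coe_comp, ContinuousLinearEquiv.coe_coe, Function.comp_apply, this,
    map_zero]

/-- Centre the degenerate homeomorphism at `y₀`. [folklore] -/
def deg (y₀ : E⁴) : E⁴ ≃ₜ E⁴ :=
  (Homeomorph.addLeft (-y₀)).trans (deg₀.trans (Homeomorph.addLeft y₀))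

/-- Value of the re-centred degenerate homeomorphism. [folklore] -/
lemma deg_apply (y₀ y : E⁴) : deg y₀ y = y₀ + deg₀ (-y₀ + y) := rfl

/-- `deg y₀` fixes `y₀`. [folklore] -/
lemma deg_self (y₀ : E⁴) : deg y₀ y₀ = y₀ := by
  rw [deg_apply, neg_add_cancel, deg₀_zero, add_zero]

/-- `deg y₀` is differentiable at `y₀` with the singular derivative `L₀`. [folklore] -/
lemma hasFDerivAt_deg (y₀ : E⁴) : HasFDerivAt (deg y₀) L₀ y₀ := by
  rw [show (deg y₀ : E⁴ → E⁴) = fun y => y₀ + deg₀ (-y₀ + y) from rfl]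
  have h1 : HasFDerivAt (fun y : E⁴ => -y₀ + y) (ContinuousLinearMap.id ℝ E⁴) y₀ :=
    (hasFDerivAt_id y₀).const_add (-y₀)
  have h2 : HasFDerivAt deg₀ L₀ (-y₀ + y₀) := by rw [neg_add_cancel]; exact hasFDerivAt_deg₀
  have h3 := (h2.comp y₀ h1).const_add y₀
  simpa using h3

/-- **The inverse of the degenerate homeomorphism is not differentiable at the centre** (chain rule:
`D(deg⁻¹) ∘ D(deg) = id` is impossible because `D(deg)(y₀) e₀ = 0`). [folklore] -/
theorem not_differentiableAt_deg_symm (y₀ : E⁴) : ¬ DifferentiableAt ℝ (deg y₀).symm y₀ := by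
  intro hd
  have hg : HasFDerivAt (deg y₀).symm (fderiv ℝ (deg y₀).symm y₀) (deg y₀ y₀) := by
    rw [deg_self]; exact hd.hasFDerivAt
  have hcomp := hg.comp y₀ (hasFDerivAt_deg y₀)
  have hid : ((deg y₀).symm ∘ (deg y₀) : E⁴ → E⁴) = id := by
    funext y; simp
  rw [hid] at hcomp
  have huniq := hcomp.unique (hasFDerivAt_id y₀)
  have := congrArg (fun T : E⁴ →L[ℝ] E⁴ => T (EuclideanSpace.single (0 : Fin 4) (1 : ℝ))) huniq
  simp only [ContinuousLinearMap.coe_comp, Function.comp_apply, L₀_single, map_zero,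
    ContinuousLinearMap.coe_id', id_eq] at this
  have h1 := congrArg (fun z : E⁴ => z 0) this
  simp at h1


/-! ### `S⁴` with a corrupted `C⁰` atlas -/

/-- A fresh copy of the topological 4-sphere (type synonym, so that instances do not leak). [folklore] -/
def Cor : Type := 𝕊⁴

/-- The topology of `S⁴`. [folklore] -/
instance instTopCor : TopologicalSpace Cor := inferInstanceAs (TopologicalSpace 𝕊⁴)
/-- `S⁴` is Hausdorff. [folklore] -/
instance instT2Cor : T2Space Cor := inferInstanceAs (T2Space 𝕊⁴)
/-- `S⁴` is second countable. [folklore] -/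
instance instSCCor : SecondCountableTopology Cor := inferInstanceAs (SecondCountableTopology 𝕊⁴)
/-- `S⁴` is compact. [folklore] -/
instance instCompactCor : CompactSpace Cor := inferInstanceAs (CompactSpace 𝕊⁴)

/-- The identity `Cor → S⁴`. [folklore] -/
def toS : Cor → 𝕊⁴ := id
/-- The identity `S⁴ → Cor`. [folklore] -/
def ofS : 𝕊⁴ → Cor := id

/-- A base point. [folklore] -/
def np : 𝕊⁴ := ⟨EuclideanSpace.single 0 1, by simp⟩

/-- The standard (stereographic) chart of `S⁴` at `np`, viewed as a chart of `Cor`. [folklore] -/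
def σ₁ : OpenPartialHomeomorph Cor E⁴ := (chartAt E⁴ np : OpenPartialHomeomorph 𝕊⁴ E⁴)

/-- The base point is in the domain of the standard chart. [folklore] -/
lemma np_mem_σ₁ : (ofS np) ∈ σ₁.source := mem_chart_source E⁴ np

/-- Its value at the base point. [folklore] -/
def y₀ : E⁴ := σ₁ (ofS np)

/-- The corrupt chart: the standard chart followed by the degenerate homeomorphism centred at `y₀`. [folklore] -/
def σ₃ : OpenPartialHomeomorph Cor E⁴ := σ₁.transHomeomorph (deg y₀)

/-- **The corrupted atlas**: all stereographic charts plus `σ₃`.  `chartAt` is the standard one, so this is a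
perfectly good `ChartedSpace` (a `C⁰` 4-manifold structure on the 4-sphere) — but NOT `IsManifold (𝓡 4) ∞`. [folklore] -/
instance corCharted : ChartedSpace E⁴ Cor where
  atlas := (ChartedSpace.atlas (H := E⁴) (M := 𝕊⁴)) ∪ {σ₃}
  chartAt x := (chartAt E⁴ (toS x) : OpenPartialHomeomorph 𝕊⁴ E⁴)
  mem_chart_source x := mem_chart_source E⁴ (toS x)
  chart_mem_atlas x := Or.inl (chart_mem_atlas E⁴ (toS x))

/-- The standard chart is in the corrupted atlas. [folklore] -/
lemma σ₁_mem_atlas : σ₁ ∈ atlas E⁴ Cor := Or.inl (chart_mem_atlas E⁴ np)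
/-- The corrupt chart is in the corrupted atlas. [folklore] -/
lemma σ₃_mem_atlas : σ₃ ∈ atlas E⁴ Cor := Or.inr rfl

/-- Membership in the `C^∞` groupoid of `ℝ⁴` is plain smoothness on the source (model with corners `= id`). [folklore] -/
lemma contDiffOn_of_mem_contDiffGroupoid {f : OpenPartialHomeomorph E⁴ E⁴}
    (hf : f ∈ contDiffGroupoid ∞ (𝓡 4)) : ContDiffOn ℝ ∞ f f.source := by
  rw [contDiffGroupoid, mem_groupoid_of_pregroupoid] at hf
  have h1 := hf.1
  simp only [contDiffPregroupoid, modelWithCornersSelf_coe, modelWithCornersSelf_coe_symm,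
    Function.comp_id, Function.id_comp, Set.range_id, Set.preimage_id, Set.inter_univ] at h1
  exact h1

/-- **No chart of the maximal `C^∞` atlas of `Cor` contains the base point**: such a chart `e` would be
smoothly compatible with both `σ₁` and `σ₃ = deg ∘ σ₁`, making `(deg y₀)⁻¹ = σ₁ ∘ e⁻¹ ∘ e ∘ σ₃⁻¹` smooth at `y₀`,
which it is not (`not_differentiableAt_deg_symm`). [folklore] -/
theorem not_mem_maximalAtlas {e : OpenPartialHomeomorph Cor E⁴} (he : e ∈ IsManifold.maximalAtlas (𝓡 4) ∞ Cor)
    (hnp : ofS np ∈ e.source) : False := by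
  rw [IsManifold.maximalAtlas, mem_maximalAtlas_iff] at he
  have hB := contDiffOn_of_mem_contDiffGroupoid (he σ₁ σ₁_mem_atlas).1   -- σ₁ ∘ e.symm
  have hA := contDiffOn_of_mem_contDiffGroupoid (he σ₃ σ₃_mem_atlas).2   -- e ∘ σ₃.symm
  -- the point w₀ = σ₃ np = y₀
  have hσ₃np : σ₃ (ofS np) = y₀ := by
    simp only [σ₃, OpenPartialHomeomorph.transHomeomorph_apply, Function.comp_apply]
    exact deg_self y₀
  have hnp₃ : ofS np ∈ σ₃.source := by
    rw [σ₃, OpenPartialHomeomorph.transHomeomorph_source]; exact np_mem_σ₁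
  -- A := e ∘ σ₃.symm is smooth at y₀
  have hAat : ContDiffAt ℝ ∞ (σ₃.symm ≫ₕ e) y₀ := by
    refine hA.contDiffAt ((σ₃.symm ≫ₕ e).open_source.mem_nhds ?_)
    rw [OpenPartialHomeomorph.trans_source]
    refine ⟨?_, ?_⟩
    · rw [OpenPartialHomeomorph.symm_source, ← hσ₃np]; exact σ₃.map_source hnp₃
    · rw [Set.mem_preimage, ← hσ₃np, σ₃.left_inv hnp₃]; exact hnp
  -- B := σ₁ ∘ e.symm is smooth at e np = A y₀
  have hBat : ContDiffAt ℝ ∞ (e.symm ≫ₕ σ₁) ((σ₃.symm ≫ₕ e) y₀) := by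
    refine hB.contDiffAt ((e.symm ≫ₕ σ₁).open_source.mem_nhds ?_)
    rw [OpenPartialHomeomorph.trans_source]
    have hval : (σ₃.symm ≫ₕ e) y₀ = e (ofS np) := by
      rw [OpenPartialHomeomorph.coe_trans, Function.comp_apply, ← hσ₃np, σ₃.left_inv hnp₃]
    rw [hval]
    refine ⟨?_, ?_⟩
    · rw [OpenPartialHomeomorph.symm_source]; exact e.map_source hnp
    · rw [Set.mem_preimage, e.left_inv hnp]; exact np_mem_σ₁
  have hcomp := hBat.comp y₀ hAat
  -- B ∘ A = (deg y₀).symm near y₀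
  have heq : ((e.symm ≫ₕ σ₁) ∘ (σ₃.symm ≫ₕ e) : E⁴ → E⁴) =ᶠ[𝓝 y₀] (deg y₀).symm := by
    have hopen : (σ₃.symm ≫ₕ e).source ∈ 𝓝 y₀ := by
      refine (σ₃.symm ≫ₕ e).open_source.mem_nhds ?_
      rw [OpenPartialHomeomorph.trans_source]
      refine ⟨?_, ?_⟩
      · rw [OpenPartialHomeomorph.symm_source, ← hσ₃np]; exact σ₃.map_source hnp₃
      · rw [Set.mem_preimage, ← hσ₃np, σ₃.left_inv hnp₃]; exact hnp
    filter_upwards [hopen] with w hw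
    rw [OpenPartialHomeomorph.trans_source, OpenPartialHomeomorph.symm_source, Set.mem_inter_iff,
      Set.mem_preimage] at hw
    obtain ⟨hw1, hw2⟩ := hw
    simp only [Function.comp_apply, OpenPartialHomeomorph.coe_trans]
    rw [e.left_inv hw2]
    simp only [σ₃, OpenPartialHomeomorph.transHomeomorph_symm_apply, Function.comp_apply]
    rw [σ₁.right_inv]
    rw [σ₃, OpenPartialHomeomorph.transHomeomorph_target] at hw1
    exact hw1
  have hsmooth : ContDiffAt ℝ ∞ (deg y₀).symm y₀ := hcomp.congr_of_eventuallyEq heq.symm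
  exact not_differentiableAt_deg_symm y₀ (hsmooth.differentiableAt (by simp))

/-- `Cor` is homotopy equivalent (indeed equal) to `S⁴`. [folklore] -/
def corHomotopyEquiv : ContinuousMap.HomotopyEquiv Cor 𝕊⁴ := ContinuousMap.HomotopyEquiv.refl 𝕊⁴

/-- **No map `Cor → ℝ⁶` is a `C^∞` immersion** (for the corrupted atlas): an immersion at the base point needs
a domain chart in the maximal atlas around it. [folklore] -/
theorem not_isImmersion (ι : Cor → EuclideanSpace ℝ (Fin 6)) : ¬ Manifold.IsImmersion (𝓡 4) (𝓡 6) ∞ ι := by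
  rintro ⟨F, _, _, hF⟩
  have h := hF (ofS np)
  exact not_mem_maximalAtlas h.domChart_mem_maximalAtlas h.mem_domChart_source

/-- **The corrupted charted space is not a `C^∞` manifold**: its own chart `σ₁` is not in the maximal atlas. [folklore] -/
theorem not_isManifold : ¬ IsManifold (𝓡 4) ∞ Cor := by
  intro h
  exact not_mem_maximalAtlas ((contDiffGroupoid ∞ (𝓡 4)).subset_maximalAtlas σ₁_mem_atlas) np_mem_σ₁

/-- **No map out of the corrupted sphere into ANY manifold is a `C^∞` immersion** (for any model with corners `J` over a real
normed space and any target charted space `N`): an immersion at the base point needs a domain chart of the maximal `C^∞` atlas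
around it, and there is none (`not_mem_maximalAtlas`).  Generalises `not_isImmersion` (review follow-up). [folklore] -/
theorem not_isImmersion_general {E'' : Type} [NormedAddCommGroup E''] [NormedSpace ℝ E''] {G : Type*} [TopologicalSpace G]
    {J : ModelWithCorners ℝ E'' G} {N : Type*} [TopologicalSpace N] [ChartedSpace G N] (ι : Cor → N) :
    ¬ Manifold.IsImmersion (𝓡 4) J ∞ ι := by
  rintro ⟨F, _, _, hF⟩
  have h := hF (ofS np)
  exact not_mem_maximalAtlas h.domChart_mem_maximalAtlas h.mem_domChart_source

end Literature.Geometry.Manifold.CorruptedAtlasSphere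

end
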